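import Summits.MatrixMultiplication.OmegaCensus.STPPSmallPatternWitnesses
import Summits.MatrixMultiplication.OmegaCensus.STPPFatQuotientLift
import Summits.MatrixMultiplication.OmegaCensus.STPPSmallPatternLawBridge
import Summits.MatrixMultiplication.OmegaCensus.STPPSmallPatternCyclicThreeAPFreeRungs
import Summits.MatrixMultiplication.OmegaCensus.STPPSmallPatternCyclicThreeAPFreeRungs17to20

/-!
# ω-census, `(1,2,2)¹⁸` host law: the last k = 18 seed type — `ℤ/11 × ℤ/5 × ℤ/4 × ℤ/2` is a T1-RAY CELL (no search)

`ℤ/11 × ℤ/5 × ℤ/4 × ℤ/2` (440) = `Q × ℤ/2` with `Q = ℤ/11 × ℤ/5 × ℤ/4 ≅ ℤ/220` of exponent `220 ≥ 214`: ENG2's cyclic T1 ray `exists_isSTPP_211pow18_zmod_of_le214`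
transported to `Q`, then the fat lift `exists_isSTPP_122_of_211_of_surjective` along the drop-last projection.  This cell was carried as OPEN since gen 29 (night-34 kit item (8)
searched it blank) although it satisfies the ray criterion of `…T2K18LinkSeedsA` — an oversight of the residual lists, repaired here (gen 30).  With `…T2K18SplitSeeds`
(`ℤ/11 × ℤ/5 × (ℤ/2)³`, `ℤ/23 × ℤ/5 × (ℤ/2)²` by the split 3-AP-free route) NO seed type of the `428` plan is open any more: the k = 18 window law files with an EMPTY
exception list (`…T2K18W428DLaw`: `exists_isSTPP_122pow18_of_card_ge_428`, the cyclic ray start).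

HONEST FRAMING (pub-omega census; verbatim): lottery ticket; floor = certified bounds/negative ranges.
Census STRUCTURE bookkeeping of the STPP track (seat pub-omega-stpp-3, gen 30; STRUCTURE row B5, columns `T1`/`T2`, §2 C10 row 18), not progress on `ω`:
small patterns in small groups bound no exponent.

References: H. Cohn, R. Kleinberg, B. Szegedy, C. Umans, FOCS 2005 (arXiv:math/0511460), Def. 5.1.  Records: HOME `pub-omega-stpp-3-g30/work/t2k18/` (generator `code/k30/mk_residual13.py`, gen 27/28/29/30).
-/

open Literature.Computability.AlgebraicComplexity Finset

namespace Summit.MatrixMultiplication.OmegaCensus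

/-- **`(2,1,1)¹⁸ ⊆ ℤ/11 × ℤ/5 × ℤ/4`** (exponent `220 ≥ 214`): ENG2's cyclic T1 ray `exists_isSTPP_211pow18_zmod_of_le214` transported along an element of maximal order — no search. [cite: CohnKleinbergSzegedyUmans2005, Def. 5.1] -/
theorem exists_isSTPP_211pow18_seed_11_5_4 :
    ∃ A B C : Fin 18 → Finset (ZMod 11 × ZMod 5 × ZMod 4), IsSTPP A B C ∧ ∀ i, (A i).card = 2 ∧ (B i).card = 1 ∧ (C i).card = 1 := by
  have hexp : AddMonoid.exponent (ZMod 11 × ZMod 5 × ZMod 4) = 220 := by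
    rw [AddMonoid.exponent_prod, AddMonoid.exponent_prod, ZMod.exponent, ZMod.exponent, ZMod.exponent]; decide
  exact exists_isSTPP_cards_of_exponent_ge (R := 214) (fun _ => True) (fun m hm _ => exists_isSTPP_211pow18_zmod_of_le214 m hm) (by rw [hexp]; norm_num) trivial

set_option maxRecDepth 8192 in
/-- The drop-last-coordinate projection `ℤ/11 × ℤ/5 × ℤ/4 × ℤ/2 → ℤ/11 × ℤ/5 × ℤ/4` has exactly two elements in its zero fibre. -/
theorem card_filter_dropLast_k18_11_5_4_2 :
    ((univ : Finset (ZMod 11 × ZMod 5 × ZMod 4 × ZMod 2)).filter (fun g => ((AddMonoidHom.id _).prodMap ((AddMonoidHom.id _).prodMap (AddMonoidHom.fst _ _)) : ZMod 11 × ZMod 5 × ZMod 4 × ZMod 2 →+ ZMod 11 × ZMod 5 × ZMod 4) g = 0)).card = 2 := by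
  decide

/-- **`(1,2,2)¹⁸ ⊆ ℤ/11 × ℤ/5 × ℤ/4 × ℤ/2`** (order `440`): ENG2's fat lift `exists_isSTPP_122_of_211_of_surjective` of `(2,1,1)¹⁸ ⊆ ℤ/11 × ℤ/5 × ℤ/4` along the drop-last-coordinate
projection (kernel `ℤ/2`). [cite: CohnKleinbergSzegedyUmans2005, Def. 5.1] -/
theorem exists_isSTPP_122pow18_seed_11_5_4_2 :
    ∃ A B C : Fin 18 → Finset (ZMod 11 × ZMod 5 × ZMod 4 × ZMod 2), IsSTPP A B C ∧ ∀ i, (A i).card = 1 ∧ (B i).card = 2 ∧ (C i).card = 2 :=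
  exists_isSTPP_122_of_211_of_surjective ((AddMonoidHom.id _).prodMap ((AddMonoidHom.id _).prodMap (AddMonoidHom.fst _ _)) : ZMod 11 × ZMod 5 × ZMod 4 × ZMod 2 →+ ZMod 11 × ZMod 5 × ZMod 4)
    (fun q => ⟨(q.1, q.2.1, q.2.2, 0), rfl⟩) card_filter_dropLast_k18_11_5_4_2 exists_isSTPP_211pow18_seed_11_5_4

end Summit.MatrixMultiplication.OmegaCensus
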